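import Summits.ResolutionOfSingularities.ResolutionOfSingularities.Theorems.MarkedTransferCampaignW46WWalkNRStepCore
import Summits.ResolutionOfSingularities.ResolutionOfSingularities.Theorems.MarkedTransferCampaignW46WWalkNRPoint
import Summits.ResolutionOfSingularities.ResolutionOfSingularities.Theorems.MarkedTransferCampaignW46MohWindowShadeFormalNRStep
import HarnessLib

/-!
# [OURS · L1 W4.6 rung (iii-2), NON-RATIONAL W-WALK, brick 4] THE FORMAL `w`-STEP AT AN ARBITRARY CLOSED POINT (scheme level): the
# `w`-anchor upstairs lives over the residue field of the point, embedded in `Ω`; its (uncleaned) residual read in `Ω⟦t,y,z⟧` is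
# `chartT p λ f^Ω` (a `T`-step at the image `λ ∈ Ω` of the point) or `chartT p 0 (swapTY f^Ω)` (the sharp-vertical step)

Cell `res-hironaka`, LADDER-RESOLUTION rung L (D-0089), slot W4.6 rung (iii); seat res-L1-s46-pv-6 (gen 8). Host route MarkedTransfer,
`--supports stmt-ResolutionOfSingularities-16155 --as helper`; kind proof (no definition). NON-RATIONAL twin of res-L1-s46-pv-5's
`…WWalkStep.exists_wAnchor_step` (p560971): NO residual-rationality hypothesis `hrat`; the coefficient field `K₀` of the anchor is any perfect
field of characteristic `p` with `ιΩ : K₀ → Ω`, `Ω` algebraically closed; the new anchor has coefficient field `K₁ = K₀(λ)` with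
`ι₁ : K₁ → Ω` extending `ιΩ`, generated over `ιΩ(K₀)` by the image `l ∈ Ω` of `λ`, a root of `π₀^{ιΩ}` for `π₀ ∈ K₀[X]` irreducible monic.
Assembly as in this seat's gen-7 `exists_formalNRAnchor_step` (adapted r.s.p., NON-RATIONAL chart data of the Rees-chart stalk, `e_z ∈ 𝔪` and the
exclusion of the `z`-chart from `f₀ ≡ u c_z^p` (`…WWalkNRPoint.exists_unit_sub_mul_pow_mem_of_lowVanish`), torus points re-read in the chart
`u₀`), with the ring-level cores `…WWalkNRStepCore.exists_ringEquiv_transform_wAnchor_nr_T/_V`. OURS; NOT a statement of H. Hironaka's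
manuscript [claim: Hironaka2017, status: under-review] (Def. 2.1 p.5 «the transform `E′`» — scope only), nothing of which is used.
AI-written; AI review is weaker than expert review. No `sorry`; axioms standard. [cite: StacksProject, Tag 0804] [cite: Matsumura1987, Thm. 8.11]
[folklore]
-/

noncomputable section

set_option linter.dupNamespace false -- mandated namespace of this single-conjunct summit

open IsLocalRing MvPowerSeries

namespace Summit.ResolutionOfSingularities.ResolutionOfSingularities.Theorems

namespace CampaignW46

namespace WWalkNR

open Literature.AlgebraicGeometry.Resolution
open WWalk
open MohWindowShadeFormalNR (exists_stalk_chartData_nr exists_reindex_nr irreducible_map_ev₀ e_mem_maximalIdeal_of_transform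
  false_of_zChart_nr span_origin_of_mem)
open CampaignW46.FormalChart
open CampaignW46.ChartPoint
open MohWindowShadeFormalStep (exists_other_index)

/-! ## §1 Embedding the grown coefficient field into `Ω` -/

section Omega

variable {K₀ : Type} [Field K₀] {Ω : Type} [Field Ω] [IsAlgClosed Ω] (ιΩ : K₀ →+* Ω)

/-- **The grown coefficient field `K₀(λ)` embeds into `Ω` over `K₀`**, `λ ↦ l` a root of `π₀^{ιΩ}`; every element of `K₀(λ)` is a `K₀`-polynomial
in `λ`, and `K₀` lands inside. [folklore] -/
theorem exists_embedding (π₀ : Polynomial K₀) [hπ : Fact (Irreducible π₀)] :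
    ∃ (ι₁ : AdjoinRoot π₀ →+* Ω) (l : Ω), (∀ x, ι₁ (AdjoinRoot.of π₀ x) = ιΩ x) ∧ ι₁ (AdjoinRoot.root π₀) = l ∧ (π₀.map ιΩ).IsRoot l ∧
      (∀ x : AdjoinRoot π₀, ∃ P : Polynomial K₀, ι₁ x = (P.map ιΩ).eval l) ∧ (∀ x : K₀, ∃ y : AdjoinRoot π₀, ι₁ y = ιΩ x) := by
  have hdeg : (π₀.map ιΩ).degree ≠ 0 := by
    rw [Polynomial.degree_map]
    exact fun h => hπ.out.not_isUnit (Polynomial.isUnit_iff_degree_eq_zero.mpr h)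
  obtain ⟨θ, hθ⟩ := IsAlgClosed.exists_root (π₀.map ιΩ) hdeg
  have hev : Polynomial.eval₂ ιΩ θ π₀ = 0 := by rw [Polynomial.eval₂_eq_eval_map]; exact hθ
  refine ⟨AdjoinRoot.lift ιΩ θ hev, θ, fun x => AdjoinRoot.lift_of hev, AdjoinRoot.lift_root hev, hθ, fun x => ?_,
    fun x => ⟨AdjoinRoot.of π₀ x, AdjoinRoot.lift_of hev⟩⟩
  obtain ⟨P, rfl⟩ := AdjoinRoot.mk_surjective x
  exact ⟨P, by rw [AdjoinRoot.lift_mk, Polynomial.eval₂_eq_eval_map]⟩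

end Omega

/-! ## §2 The formal `w`-step at an arbitrary closed point (scheme level) -/

section Scheme

open CategoryTheory AlgebraicGeometry TopologicalSpace
open Literature.AlgebraicGeometry.Hironaka2017.S02Preliminaries
open Literature.AlgebraicGeometry.Hironaka2017.Datum
open Scheme.IdealSheafData

variable {p : ℕ} [hp : Fact p.Prime] {K : Type} [Field K] [CharP K p]
  {K₀ : Type} [Field K₀] [CharP K₀ p] [PerfectField K₀]
  {Ω : Type} [Field Ω] [IsAlgClosed Ω] (ιΩ : K₀ →+* Ω)

/-- [OURS · L1 W4.6 rung (iii-2) — THE FORMAL `w`-STEP AT AN ARBITRARY CLOSED POINT; replaces the role of «the transform `E′` of `E` by the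
blowup with center `D`» (H. Hironaka, ms. 2017, Def. 2.1 p.5) for a GENERAL window germ at a point that need NOT be residually rational; NOT a
statement of the manuscript] Inputs: the blow-up `π` of an ambient datum along the reduced closed point `ξ = π(ξ′) ∈ Sing(E)`, `E.b = p`,
`𝒪_{Z,ξ}` and `𝒪_{Z′,ξ′}` regular of embedding dimension `3`, `ξ′ ∈ Sing(E′)`, a `w`-anchor `E₀(f₀) = w · (z^p + f)` of `J_ξ = (f₀)` over a
perfect field `K₀` with `ord f ≥ p + 1`, and `ιΩ : K₀ → Ω` into an algebraically closed field. Output: a `w`-anchor `E′(f′) = w′ · (z^p + f₁)`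
of `J′_{ξ′}` over a perfect field `K₁` with `ι₁ : K₁ → Ω` whose image contains `ιΩ(K₀)` and is generated over it by `l ∈ Ω`, a root of
`π₀^{ιΩ}` (`π₀ ∈ K₀[X]` irreducible monic), and the uncleaned residual read in `Ω`: EITHER `f₁ ⊗ Ω = chartT p l (f ⊗ Ω)` (a `T`-step) OR
`l = 0` and `f₁ ⊗ Ω = chartT p 0 (swapTY (f ⊗ Ω))` (the sharp-vertical step). [cite: StacksProject, Tag 0804] [cite: Matsumura1987, Thm. 8.11] -/
theorem exists_wAnchor_step_nr {A A' : AmbientDatum p K} (π : A'.Z ⟶ A.Z) (D : Closeds A.Z) (hπ : IsBlowup π (vanishingIdeal D))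
    {E : IdealExponent A.Z} (hb : E.b = p) {ξ' : A'.Z} (hD : (D : Set A.Z) = {π.base ξ'}) (hξ : π.base ξ' ∈ E.sing)
    (hξ' : ξ' ∈ (E.transform π D).sing) (h3 : (maximalIdeal (A.Z.presheaf.stalk (π.base ξ'))).spanFinrank = 3)
    (hreg' : IsRegularLocalRing (A'.Z.presheaf.stalk ξ')) (h3' : (maximalIdeal (A'.Z.presheaf.stalk ξ')).spanFinrank = 3)
    (E₀ : AdicCompletion (maximalIdeal (A.Z.presheaf.stalk (π.base ξ'))) (A.Z.presheaf.stalk (π.base ξ')) ≃+*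
      MvPowerSeries (Option (Fin 2)) K₀)
    {f₀ : A.Z.presheaf.stalk (π.base ξ')} (hJ : stalkIdeal E.J (π.base ξ') = Ideal.span {f₀}) {w : MvPowerSeries (Option (Fin 2)) K₀}
    (hw : IsUnit w) (f : MvPowerSeries (Option (Fin 2)) K₀) (hfP2 : LowVanish (p + 1) f)
    (hE₀ : E₀ (algebraMap _ _ f₀) = w * (X none ^ p + f)) :
    ∃ (K₁ : Type) (_ : Field K₁) (_ : CharP K₁ p) (_ : PerfectField K₁) (ι₁ : K₁ →+* Ω)
      (E' : AdicCompletion (maximalIdeal (A'.Z.presheaf.stalk ξ')) (A'.Z.presheaf.stalk ξ') ≃+* MvPowerSeries (Option (Fin 2)) K₁)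
      (f' : A'.Z.presheaf.stalk ξ') (w' f₁ : MvPowerSeries (Option (Fin 2)) K₁) (π₀ : Polynomial K₀) (v : Bool) (l : Ω),
      (∀ x : K₀, ∃ y : K₁, ι₁ y = ιΩ x) ∧ Irreducible π₀ ∧ π₀.Monic ∧ (π₀.map ιΩ).IsRoot l ∧ (∃ y : K₁, ι₁ y = l) ∧
      (∀ x : K₁, ∃ P : Polynomial K₀, ι₁ x = (P.map ιΩ).eval l) ∧
      stalkIdeal (E.transform π D).J ξ' = Ideal.span {f'} ∧ IsUnit w' ∧ E' (algebraMap _ _ f') = w' * (X none ^ p + f₁) ∧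
      (v = false → MvPowerSeries.map ι₁ f₁ = chartT p l (MvPowerSeries.map ιΩ f)) ∧
      (v = true → l = 0 ∧ MvPowerSeries.map ι₁ f₁ = chartT p (0 : Ω) (swapTY (MvPowerSeries.map ιΩ f))) := by
  classical
  haveI : IsLocallyNoetherian A'.Z := ambient_isLocallyNoetherian A'
  haveI : IsRegularLocalRing (A.Z.presheaf.stalk (π.base ξ')) := ambient_isRegular A _
  haveI := hreg'
  set g := (π.stalkMap ξ').hom with hgdef
  have hloc : IsLocalHom g := inferInstance
  have hg : (maximalIdeal (A.Z.presheaf.stalk (π.base ξ'))).map g ≤ maximalIdeal (A'.Z.presheaf.stalk ξ') :=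
    ((IsLocalRing.local_hom_TFAE g).out 0 2).mp hloc
  -- an adapted regular system of parameters at `π ξ′`
  obtain ⟨c, hc, hcX⟩ := exists_rsop_adapted E₀
  have hcl : IsClosed ({π.base ξ'} : Set A.Z) := hD ▸ D.isClosed
  have hcJ : Ideal.span (Set.range c) = stalkIdeal (vanishingIdeal D) (π.base ξ') := by
    rw [hc, stalkIdeal_vanishingIdeal_eq_maximalIdeal_of_closure_eq]
    rw [hD, hcl.closure_eq]
  have hd' : (maximalIdeal (A.Z.presheaf.stalk (π.base ξ'))).spanFinrank = Fintype.card (Option (Fin 2)) := by rw [h3]; simp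
  have hdimL : ringKrullDim (A'.Z.presheaf.stalk ξ') = Fintype.card (Option (Fin 2)) := by
    have h := IsRegularLocalRing.spanFinrank_maximalIdeal (R := A'.Z.presheaf.stalk ξ')
    rw [h3'] at h; rw [← h]; simp
  have hdimL3 : ringKrullDim (A'.Z.presheaf.stalk ξ') = 3 := by rw [hdimL]; simp
  obtain ⟨i, e, he, hei, hnzd, hNoeth, hcont⟩ := exists_stalk_chartData_nr hπ ξ' c hcJ hc hd' hdimL
  haveI := hNoeth
  -- `f₀ ∈ 𝔪^p` and `f₀ ≡ u c_z^p (mod 𝔪^{p+1})`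
  have hf₀𝔪 : f₀ ∈ maximalIdeal (A.Z.presheaf.stalk (π.base ξ')) ^ p := by
    have h := (le_idealOrder_iff E.J _ E.b).mp hξ
    rw [hJ, Ideal.span_singleton_le_iff_mem, hb] at h
    exact h
  obtain ⟨u, hu, hf₀u⟩ := exists_unit_sub_mul_pow_mem_of_lowVanish E₀ c hcX f₀ w hw f hfP2 hE₀
  -- the controlled transform in the chart `c_i` and its singularity
  obtain ⟨f', hf'⟩ := exists_eq_pow_mul_of_mem_pow g c hc i e he hf₀𝔪
  have hJ' : stalkIdeal (E.transform π D).J ξ' = Ideal.span {f'} :=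
    stalkIdeal_transform_eq_span hπ ξ' c hcJ i e he hnzd E f₀ hJ f' (by rw [hb]; exact hf')
  have hf'𝔪 : f' ∈ maximalIdeal (A'.Z.presheaf.stalk ξ') ^ p := by
    have h := (mem_sing_transform_iff E ξ' f' hJ').mp hξ'
    rwa [hb] at h
  have hf'𝔪1 : f' ∈ maximalIdeal (A'.Z.presheaf.stalk ξ') := Ideal.pow_le_self hp.out.ne_zero hf'𝔪
  set ev₀ := (MvPowerSeries.constantCoeff.comp (E₀ : AdicCompletion (maximalIdeal (A.Z.presheaf.stalk (π.base ξ'))) (A.Z.presheaf.stalk (π.base ξ')) →+*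
      MvPowerSeries (Option (Fin 2)) K₀)).comp
    (algebraMap (A.Z.presheaf.stalk (π.base ξ')) (AdicCompletion (maximalIdeal (A.Z.presheaf.stalk (π.base ξ'))) (A.Z.presheaf.stalk (π.base ξ'))))
    with hev₀
  -- the conclusion from non-rational chart data in a `u`-chart `some j₀` (Hauser–Wagner frame: `j₀ = 1` only at the origin, `π = X`)
  have tail : ∀ (j₀ j₁ : Fin 2) (hj : j₁ ≠ j₀) (htwo : ∀ l, l = j₀ ∨ l = j₁) (e : Option (Fin 2) → A'.Z.presheaf.stalk ξ')
      (πR : Polynomial (A.Z.presheaf.stalk (π.base ξ'))),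
      (∀ j, g (c j) = g (c (some j₀)) * e j) → g (c (some j₀)) ∈ nonZeroDivisors (A'.Z.presheaf.stalk ξ') → πR.Monic →
      Irreducible (πR.map (residue (A.Z.presheaf.stalk (π.base ξ')))) →
      Ideal.span {g (c (some j₀)), e none, (πR.map g).eval (e (some j₁))} = maximalIdeal (A'.Z.presheaf.stalk ξ') →
      (∀ y : A'.Z.presheaf.stalk ξ', ∃ P : Polynomial (A.Z.presheaf.stalk (π.base ξ')), y - (P.map g).eval (e (some j₁)) ∈ maximalIdeal _) →
      (j₀ = 1 → πR.map ev₀ = Polynomial.X) →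
      ∃ (K₁ : Type) (_ : Field K₁) (_ : CharP K₁ p) (_ : PerfectField K₁) (ι₁ : K₁ →+* Ω)
        (E' : AdicCompletion (maximalIdeal (A'.Z.presheaf.stalk ξ')) (A'.Z.presheaf.stalk ξ') ≃+* MvPowerSeries (Option (Fin 2)) K₁)
        (f' : A'.Z.presheaf.stalk ξ') (w' f₁ : MvPowerSeries (Option (Fin 2)) K₁) (π₀ : Polynomial K₀) (v : Bool) (l : Ω),
        (∀ x : K₀, ∃ y : K₁, ι₁ y = ιΩ x) ∧ Irreducible π₀ ∧ π₀.Monic ∧ (π₀.map ιΩ).IsRoot l ∧ (∃ y : K₁, ι₁ y = l) ∧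
        (∀ x : K₁, ∃ P : Polynomial K₀, ι₁ x = (P.map ιΩ).eval l) ∧
        stalkIdeal (E.transform π D).J ξ' = Ideal.span {f'} ∧ IsUnit w' ∧ E' (algebraMap _ _ f') = w' * (X none ^ p + f₁) ∧
        (v = false → MvPowerSeries.map ι₁ f₁ = chartT p l (MvPowerSeries.map ιΩ f)) ∧
        (v = true → l = 0 ∧ MvPowerSeries.map ι₁ f₁ = chartT p (0 : Ω) (swapTY (MvPowerSeries.map ιΩ f))) := by
    intro j₀ j₁ hj htwo e πR he hnzd hm hirr hgen hres hHW
    set π₀ := πR.map ev₀ with hπ₀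
    have hirr₀ : Irreducible π₀ := irreducible_map_ev₀ E₀ hirr
    haveI : Fact (Irreducible π₀) := ⟨hirr₀⟩
    have hm₀ : π₀.Monic := hm.map _
    obtain ⟨f'', hf''⟩ := exists_eq_pow_mul_of_mem_pow g c hc (some j₀) e he hf₀𝔪
    have hJ'' : stalkIdeal (E.transform π D).J ξ' = Ideal.span {f''} :=
      stalkIdeal_transform_eq_span hπ ξ' c hcJ (some j₀) e he hnzd E f₀ hJ f'' (by rw [hb]; exact hf'')
    haveI : Module.Finite K₀ (AdjoinRoot π₀) := (AdjoinRoot.powerBasis hirr₀.ne_zero).finite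
    haveI : PerfectField (AdjoinRoot π₀) := Algebra.IsAlgebraic.perfectField K₀
    haveI : CharP (AdjoinRoot π₀) p := charP_of_injective_ringHom (AdjoinRoot.of π₀).injective p
    obtain ⟨ι₁, l, hι₁of, hι₁root, hroot, hgenK₁, hsub⟩ := exists_embedding ιΩ π₀
    have hcomp : ι₁.comp (AdjoinRoot.of π₀) = ιΩ := RingHom.ext hι₁of
    have hmapmap : ∀ h : MvPowerSeries (Option (Fin 2)) K₀, MvPowerSeries.map ι₁ (MvPowerSeries.map (AdjoinRoot.of π₀) h) = MvPowerSeries.map ιΩ h := by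
      intro h
      rw [MvPowerSeries.map_map, hcomp]
    by_cases h0 : j₀ = 0
    · -- `T`-step in the chart `u₀`
      obtain ⟨E', w', hw', -, hE'⟩ := exists_ringEquiv_transform_wAnchor_nr_T g hg E₀ c hc hcX hj htwo e he πR hm π₀ rfl hgen hres hdimL3 h0
        f hfP2 f₀ w hw hE₀ f'' hf''
      refine ⟨AdjoinRoot π₀, inferInstance, inferInstance, inferInstance, ι₁, E', f'', w', _, π₀, false, l, hsub, hirr₀, hm₀, hroot, ⟨_, hι₁root⟩, hgenK₁, hJ'',
        hw', hE', fun _ => ?_, fun h => absurd h (by decide)⟩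
      rw [chartT_map, hι₁root, hmapmap]
    · -- the origin of the chart `u₁`: the sharp-vertical step
      have h1 : j₀ = 1 := by
        rcases j₀ with ⟨_ | _ | k, hk⟩
        · exact absurd rfl h0
        · rfl
        · omega
      obtain ⟨E', w', hw', -, hE'⟩ := exists_ringEquiv_transform_wAnchor_nr_V g hg E₀ c hc hcX hj htwo e he πR hm π₀ rfl hgen hres hdimL3 h1
        (hHW h1) f hfP2 f₀ w hw hE₀ f'' hf''
      have hl0 : l = 0 := by
        rw [← hι₁root, ← AdjoinRoot.mk_X]
        have h2 : AdjoinRoot.mk π₀ Polynomial.X = AdjoinRoot.mk π₀ π₀ := congrArg (fun q => AdjoinRoot.mk π₀ q) (hHW h1).symm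
        rw [h2, AdjoinRoot.mk_self, map_zero]
      refine ⟨AdjoinRoot π₀, inferInstance, inferInstance, inferInstance, ι₁, E', f'', w', _, π₀, true, l, hsub, hirr₀, hm₀, hroot, ⟨_, hι₁root⟩, hgenK₁, hJ'',
        hw', hE', fun h => absurd h (by decide), fun _ => ⟨hl0, ?_⟩⟩
      rw [chartT_map, map_zero, swapTY_map, hmapmap]
  -- case analysis on the chart delivered by the Rees-chart presentation
  cases i with
  | none => exact (false_of_zChart_nr c hc g hg e he hnzd hu hf₀u f' hf' hf'𝔪1).elim
  | some i₀ =>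
    have hez : e none ∈ maximalIdeal (A'.Z.presheaf.stalk ξ') := e_mem_maximalIdeal_of_transform c hc g hg e he hnzd hu hf₀u f' hf' hf'𝔪1
    obtain ⟨i₁, hi, htwo⟩ := exists_other_index i₀
    have hall : ∀ j : Option (Fin 2), j = some i₀ ∨ j = some i₁ ∨ j = none := by
      intro j
      cases j with
      | none => exact Or.inr (Or.inr rfl)
      | some l => rcases htwo l with rfl | rfl <;> simp
    obtain ⟨πR, hm, hirr, hgen, hres⟩ := hcont (some i₁) none (fun h => hi (Option.some_injective _ h)) (Option.some_ne_none i₀).symm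
      (Option.some_ne_none i₁) hall hez
    by_cases hHW : i₀ = 1 → e (some i₁) ∈ maximalIdeal (A'.Z.presheaf.stalk ξ')
    · by_cases h1 : i₀ = 1
      · -- the origin of the chart `u₁`: `π̃ := X`
        exact tail i₀ i₁ hi htwo e Polynomial.X he hnzd Polynomial.monic_X (by rw [Polynomial.map_X]; exact Polynomial.irreducible_X)
          (span_origin_of_mem c hc g e he πR hgen (hHW h1)) (by simpa only [Polynomial.map_X, Polynomial.eval_X] using hres)
          (fun _ => by rw [Polynomial.map_X])
      · exact tail i₀ i₁ hi htwo e πR he hnzd hm hirr hgen hres (fun h => absurd h h1)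
    · -- a torus point delivered in the chart `u₁`: re-read it in the chart `u₀`
      rw [Classical.not_imp] at hHW
      obtain ⟨h1, hey⟩ := hHW
      have hv : IsUnit (e (some i₁)) := (IsLocalRing.notMem_maximalIdeal).mp hey
      obtain ⟨v', hvv'⟩ := hv.exists_right_inv
      obtain ⟨ρR, hρm, hρirr, hgen', hres'⟩ :=
        exists_reindex_nr g hg (g (c (some i₀))) (e none) (e (some i₁)) v' hvv' πR hm hirr hgen hres
      set e'' : Option (Fin 2) → A'.Z.presheaf.stalk ξ' := fun j => e j * v' with he''def
      have he'' : ∀ j, g (c j) = g (c (some i₁)) * e'' j := fun j => by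
        rw [he''def]; dsimp only
        rw [he (some i₁), he j]
        calc g (c (some i₀)) * e j = g (c (some i₀)) * (e (some i₁) * v') * e j := by rw [hvv', mul_one]
          _ = g (c (some i₀)) * e (some i₁) * (e j * v') := by ring
      have hnzd'' : g (c (some i₁)) ∈ nonZeroDivisors (A'.Z.presheaf.stalk ξ') := by
        rw [he (some i₁)]; exact mul_mem hnzd hv.mem_nonZeroDivisors
      have he''0 : e'' (some i₀) = v' := by rw [he''def]; dsimp only; rw [hei, one_mul]
      have he''z : e'' none = e none * v' := rfl
      have hgen'' : Ideal.span {g (c (some i₁)), e'' none, (ρR.map g).eval (e'' (some i₀))} = maximalIdeal (A'.Z.presheaf.stalk ξ') := by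
        rw [he''0, he''z, he (some i₁)]; exact hgen'
      have hres'' : ∀ y : A'.Z.presheaf.stalk ξ', ∃ Q : Polynomial (A.Z.presheaf.stalk (π.base ξ')),
          y - (Q.map g).eval (e'' (some i₀)) ∈ maximalIdeal _ := fun y => by rw [he''0]; exact hres' y
      have htwo' : ∀ l, l = i₁ ∨ l = i₀ := fun l => (htwo l).symm
      have hi₁ : i₁ ≠ 1 := fun h => hi (h.trans h1.symm)
      exact tail i₁ i₀ (Ne.symm hi) htwo' e'' ρR he'' hnzd'' hρm hρirr hgen'' hres'' (fun h => absurd h hi₁)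

end Scheme

end WWalkNR

end CampaignW46

end Summit.ResolutionOfSingularities.ResolutionOfSingularities.Theorems

end
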